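import Summits.ResolutionOfSingularities.ResolutionOfSingularities.Theorems.FrobeniusLadderFInjectiveMacaulayficationE4GermSpecimen
import Summits.ResolutionOfSingularities.ResolutionOfSingularities.Theorems.FrobeniusLadderFInjectiveMacaulayficationFCentreE1ChartPresentation
import Literature.AlgebraicGeometry.Resolution.AffineBlowupIntegral
import Literature.AlgebraicGeometry.Resolution.BlowupsFlatBaseChange
import Literature.AlgebraicGeometry.Resolution.CanonicalResolutionProofs
import HarnessLib

/-!
# E4″@G (F2): THE SINGULAR CENTRE `𝓚_E` ON THE POINT BLOW-UP `X₁ = Bl_𝔪 G` OF `G = {ab + w₁³ + w₂³ + w₃³ = 0}` (char 2, any field) — scheme-level half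
# (crux `FInjectiveMacaulayfication` stmt-ResolutionOfSingularities-15315, chain w45a; res-L1-w45a-plan-1 RULING R18.32 (2) «lead-1 TAKES (F2)»;
# res-L1-w45a-stub-3's typing plan `g9/E4-STEP-TYPING.md` §B (F2); consumer = the (ROW) `tStepInstanceAt_G_origin` via `TStepGerm.tStepInstanceAt_of_isBlowup` (p621847)
# and res-L1-w45a-stub-1's (F3))

[OURS · L1 W4.5a] Support file (`--supports stmt-ResolutionOfSingularities-15315 --as helper`); replaces the role of NO printed item; NOT a statement of any
manuscript; def-free; UNCONDITIONAL. AI-written (AI review is weaker than expert review).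

THE OBJECTS. `G = Spec (k[X₀..X₄]/(f))`, `f = X₀X₁ + X₂³ + X₃³ + X₄³` (`char k = 2`, any field), `v` = the vertex, `𝔪 = (x̄₀, …, x̄₄)`, `X₁ := affineBlowup 𝔪`,
`π₁ := affineBlowup.π 𝔪` (floor 1 of the T″(2,4,·) instance at `(G, v)`; FULL at every point by res-L1-w45a-stub-2's (F1) p625934). The floor-2 centre of
E4-STEP is the REDUCED SINGULAR LOCUS of `X₁`: `𝓚_E := Scheme.IdealSheafData.vanishingIdeal Z` for the closed set `Z = (Reg X₁)ᶜ` (canonical, chart-free).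
Statements take the centre as a binder `(𝔪) (h𝔪 : 𝔪 = Ideal.span (Set.range x̄))` (instantiate with `rfl`; then `affineBlowup 𝔪` is (F1)'s `affineBlowup (Ideal.span …)` on the nose).
THIS FILE proves the two scheme-level binders `TStepGerm.tStepInstanceAt_of_isBlowup` asks of the centre, for ANY `Z : Closeds X₁` with `↑Z = (Reg X₁)ᶜ`:
* §1 `π_eq_vertex_of_not_mem_regularLocus` — a non-regular point of `X₁` lies over `v` (`G` is regular off `v`, `E4GermSpecimen.regular_off_vertex`, and `π₁` is an
  isomorphism over each `D(x̄ⱼ)`, Stacks 02OS `affineBlowup.isIso_morphismRestrict`); `exists_over_generic` — a point of `X₁` over the generic point of `G`;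
* §2 `isClosed_compl_regularLocus` (so `Z` exists: `X₁ → Spec k` is locally of finite type; Matsumura Cor. to 30.5 as `isOpen_regularLocus_of_locallyOfFiniteType_field`),
  `vanishingIdeal_ne_bot`, ★ `support_vanishingIdeal_over_vertex` (the `hsupp` binder: every point of `Supp 𝓚_E` over a generization of `v` lies over `v` — in fact
  every point of `Supp 𝓚_E` does), ★ `comap_pullback_fst_vanishingIdeal_ne_bot` (the `h𝓚` binder: `𝓚_E·𝒪_{X₁ ×_G Spec 𝒪_{G,v}} ≠ ⊥`).
The chart identification `𝓚_E|_{D₊(wᵢ)} = (a′, b′, wᵢ, g)~` (for (F3)) is the companion file's business (`comap_vanishingIdeal_of_isOpenImmersion` + a Jacobian /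
`h ∈ 𝔞²` certificate), stated there in the chart presentation (F3) consumes.
[cite: StacksProject, Tag 02OS] [cite: Matsumura1987, §30, Cor. to Thm. 30.5] [cite: GortzWedhorn2020, Prop. 13.91 (2)]
-/

-- single-problem summit: the doubled namespace component is forced
set_option linter.dupNamespace false

noncomputable section

namespace Summit.ResolutionOfSingularities.ResolutionOfSingularities.Theorems.FInjectiveMacaulayfication.E4GermSingularCentre

open CategoryTheory AlgebraicGeometry TopologicalSpace IsLocalRing MvPolynomial
open Literature.AlgebraicGeometry.Resolution
open Summit.ResolutionOfSingularities.ResolutionOfSingularities.Theorems.FInjectiveMacaulayfication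
open E4GermSpecimen

universe u

variable (k : Type) [Field k]

/-! ## §1 Non-regular points of `X₁ = Bl_𝔪 G` lie over the vertex -/

/-- ★ **A non-regular point of `Bl_𝔪 G` lies over the vertex**: off `π₁⁻¹(v)` the blow-up is an isomorphism onto `G ∖ {v}` (Stacks 02OS over each `D(x̄ⱼ)`),
and `G` is regular off `v`. [cite: StacksProject, Tag 02OS] -/
theorem π_eq_vertex_of_not_mem_regularLocus [CharP k 2] (f : MvPolynomial (Fin 5) k)
    (hf : f = X 0 * X 1 + X 2 ^ 3 + X 3 ^ 3 + X 4 ^ 3)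
    (v : Spec (.of (MvPolynomial (Fin 5) k ⧸ Ideal.span {f})))
    (hv : v.asIdeal = Ideal.span (Set.range fun j : Fin 5 => Ideal.Quotient.mk (Ideal.span {f}) (X j)))
    (𝔪 : Ideal (MvPolynomial (Fin 5) k ⧸ Ideal.span {f})) (h𝔪 : 𝔪 = Ideal.span (Set.range fun j : Fin 5 => Ideal.Quotient.mk (Ideal.span {f}) (X j)))
    (x₁ : ↥(affineBlowup 𝔪)) (hx₁ : x₁ ∉ Scheme.regularLocus (affineBlowup 𝔪)) :
    (affineBlowup.π 𝔪).base x₁ = v := by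
  classical
  by_contra hne
  -- `𝔪 ⊄ w`: otherwise `w = v` by maximality of `𝔪`
  have hmax : 𝔪.IsMaximal := by
    rw [h𝔪]; exact DoublePointFermatCubicGerm.isMaximal_origin k f (constantCoeff_f k f hf)
  have hnotle : ¬ 𝔪 ≤ ((affineBlowup.π 𝔪).base x₁).asIdeal := by
    intro hle
    apply hne
    apply PrimeSpectrum.ext
    rw [hv, ← h𝔪]
    exact (hmax.eq_of_le ((affineBlowup.π 𝔪).base x₁).isPrime.ne_top hle).symm
  -- a generator `x̄ⱼ ∉ w`
  obtain ⟨j, hj⟩ : ∃ j : Fin 5, Ideal.Quotient.mk (Ideal.span {f}) (X j) ∉ ((affineBlowup.π 𝔪).base x₁).asIdeal := by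
    by_contra hall
    push Not at hall
    exact hnotle (h𝔪.le.trans (Ideal.span_le.mpr (by rintro _ ⟨j, rfl⟩; exact hall j)))
  have hjm : Ideal.Quotient.mk (Ideal.span {f}) (X j) ∈ 𝔪 := h𝔪 ▸ Ideal.subset_span ⟨j, rfl⟩
  haveI := affineBlowup.isIso_morphismRestrict (I := 𝔪) (Ideal.Quotient.mk (Ideal.span {f}) (X j)) hjm
  have hwU : (affineBlowup.π 𝔪).base x₁ ∈ PrimeSpectrum.basicOpen (Ideal.Quotient.mk (Ideal.span {f}) (X j)) :=
    (PrimeSpectrum.mem_basicOpen _ _).mpr hj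
  have hwreg : (affineBlowup.π 𝔪).base x₁ ∈ Scheme.regularLocus (Spec (.of (MvPolynomial (Fin 5) k ⧸ Ideal.span {f}))) :=
    FermatCubicConeGerm.mem_regularLocus_Spec_of_isRegularLocalRing _ (regular_off_vertex k f hf _ (h𝔪 ▸ hnotle))
  exact hx₁ ((mem_regularLocus_iff_of_isIso_morphismRestrict (affineBlowup.π 𝔪)
    (PrimeSpectrum.basicOpen (Ideal.Quotient.mk (Ideal.span {f}) (X j))) x₁ hwU).mpr hwreg)

/-- `𝔪 ≠ ⊥` (`x̄₂ ≠ 0` in the domain `k[X]/(f)`). [folklore] -/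
theorem centre_ne_bot (f : MvPolynomial (Fin 5) k) (hf : f = X 0 * X 1 + X 2 ^ 3 + X 3 ^ 3 + X 4 ^ 3)
    (𝔪 : Ideal (MvPolynomial (Fin 5) k ⧸ Ideal.span {f})) (h𝔪 : 𝔪 = Ideal.span (Set.range fun j : Fin 5 => Ideal.Quotient.mk (Ideal.span {f}) (X j))) :
    𝔪 ≠ ⊥ := by
  haveI hfprime : (Ideal.span {f}).IsPrime := (Ideal.span_singleton_prime (prime_f k f hf).ne_zero).mpr (prime_f k f hf)
  have h2m : Ideal.Quotient.mk (Ideal.span {f}) (X 2) ∈ 𝔪 := h𝔪 ▸ Ideal.subset_span ⟨2, rfl⟩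
  have h20 : Ideal.Quotient.mk (Ideal.span {f}) (X 2 : MvPolynomial (Fin 5) k) ≠ 0 :=
    FCentreE1ChartPresentation.mk_X_ne_zero_of_eval k f hfprime 2 (Pi.single 3 1) (by simp) (by rw [hf]; simp)
  exact fun h0 => h20 (by rw [← Ideal.mem_bot, ← h0]; exact h2m)

/-- **A point of `Bl_𝔪 G` over the generic point of `G`** (the blow-up is surjective, Stacks 02OS): over a generization of `v`, NOT over `v`, and a regular
point of `Bl_𝔪 G` (§1). [cite: StacksProject, Tag 02OS] -/
theorem exists_over_generic [CharP k 2] (f : MvPolynomial (Fin 5) k)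
    (hf : f = X 0 * X 1 + X 2 ^ 3 + X 3 ^ 3 + X 4 ^ 3)
    (v : Spec (.of (MvPolynomial (Fin 5) k ⧸ Ideal.span {f})))
    (hv : v.asIdeal = Ideal.span (Set.range fun j : Fin 5 => Ideal.Quotient.mk (Ideal.span {f}) (X j)))
    (𝔪 : Ideal (MvPolynomial (Fin 5) k ⧸ Ideal.span {f})) (h𝔪 : 𝔪 = Ideal.span (Set.range fun j : Fin 5 => Ideal.Quotient.mk (Ideal.span {f}) (X j))) :
    ∃ x₁ : ↥(affineBlowup 𝔪), (affineBlowup.π 𝔪).base x₁ ⤳ v ∧ (affineBlowup.π 𝔪).base x₁ ≠ v ∧ x₁ ∈ Scheme.regularLocus (affineBlowup 𝔪) := by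
  classical
  haveI hfprime : (Ideal.span {f}).IsPrime := (Ideal.span_singleton_prime (prime_f k f hf).ne_zero).mpr (prime_f k f hf)
  haveI : IsDomain (MvPolynomial (Fin 5) k ⧸ Ideal.span {f}) := Ideal.Quotient.isDomain _
  have h𝔪ne : 𝔪 ≠ ⊥ := centre_ne_bot k f hf 𝔪 h𝔪
  -- the generic point `η` of `G` and a point of the blow-up over it
  let η : Spec (.of (MvPolynomial (Fin 5) k ⧸ Ideal.span {f})) := ⟨⊥, Ideal.isPrime_bot⟩
  obtain ⟨x₁, hx₁⟩ := affineBlowup.surjective h𝔪ne η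
  have hηv : η ⤳ v := (PrimeSpectrum.le_iff_specializes η v).mp bot_le
  have hηne : η ≠ v := by
    intro h
    have : (v.asIdeal : Ideal _) = ⊥ := by rw [← h]
    rw [hv, ← h𝔪] at this
    exact h𝔪ne this
  refine ⟨x₁, by rw [hx₁]; exact hηv, by rw [hx₁]; exact hηne, ?_⟩
  by_contra hreg
  exact hηne (hx₁ ▸ π_eq_vertex_of_not_mem_regularLocus k f hf v hv 𝔪 h𝔪 x₁ hreg)

/-! ## §2 The singular centre `𝓚_E = vanishingIdeal Z`, `↑Z = (Reg X₁)ᶜ`: closedness, `≠ ⊥`, support over the vertex, non-vanishing on the local model -/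

/-- **The non-regular locus of `Bl_𝔪 G` is closed**: `Bl_𝔪 G → G → Spec k` is locally of finite type (the blow-up is proper; `G` is of finite type), and the regular
locus of a scheme locally of finite type over a field is open. [cite: Matsumura1987, §30, Cor. to Thm. 30.5] -/
theorem isClosed_compl_regularLocus (f : MvPolynomial (Fin 5) k) (𝔪 : Ideal (MvPolynomial (Fin 5) k ⧸ Ideal.span {f})) :
    IsClosed (Scheme.regularLocus (affineBlowup 𝔪))ᶜ := by
  haveI : IsNoetherianRing (MvPolynomial (Fin 5) k ⧸ Ideal.span {f}) := inferInstance
  have hs : LocallyOfFiniteType (Spec.map (CommRingCat.ofHom (algebraMap k (MvPolynomial (Fin 5) k ⧸ Ideal.span {f})))) := by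
    rw [HasRingHomProperty.Spec_iff (P := @LocallyOfFiniteType), CommRingCat.hom_ofHom, RingHom.finiteType_algebraMap]
    infer_instance
  haveI := hs
  haveI : LocallyOfFiniteType (affineBlowup.π 𝔪 ≫ Spec.map (CommRingCat.ofHom (algebraMap k (MvPolynomial (Fin 5) k ⧸ Ideal.span {f})))) :=
    inferInstance
  exact (isOpen_regularLocus_of_locallyOfFiniteType_field
    (affineBlowup.π 𝔪 ≫ Spec.map (CommRingCat.ofHom (algebraMap k (MvPolynomial (Fin 5) k ⧸ Ideal.span {f}))))).isClosed_compl

/-- ★ **`hsupp` (strong form)**: every point of the support of `𝓚_E = vanishingIdeal Z` (`↑Z = (Reg X₁)ᶜ`) lies over the vertex. [cite: StacksProject, Tag 02OS] -/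
theorem support_vanishingIdeal_over_vertex [CharP k 2] (f : MvPolynomial (Fin 5) k)
    (hf : f = X 0 * X 1 + X 2 ^ 3 + X 3 ^ 3 + X 4 ^ 3)
    (v : Spec (.of (MvPolynomial (Fin 5) k ⧸ Ideal.span {f})))
    (hv : v.asIdeal = Ideal.span (Set.range fun j : Fin 5 => Ideal.Quotient.mk (Ideal.span {f}) (X j)))
    (𝔪 : Ideal (MvPolynomial (Fin 5) k ⧸ Ideal.span {f})) (h𝔪 : 𝔪 = Ideal.span (Set.range fun j : Fin 5 => Ideal.Quotient.mk (Ideal.span {f}) (X j)))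
    (Z : Closeds ↥(affineBlowup 𝔪)) (hZ : (Z : Set ↥(affineBlowup 𝔪)) = (Scheme.regularLocus (affineBlowup 𝔪))ᶜ) :
    ∀ x₁ ∈ ((Scheme.IdealSheafData.vanishingIdeal Z).support : Set ↥(affineBlowup 𝔪)),
      (affineBlowup.π 𝔪).base x₁ ⤳ v → (affineBlowup.π 𝔪).base x₁ = v := by
  intro x₁ hx₁ _
  rw [Scheme.IdealSheafData.coe_support_vanishingIdeal, hZ] at hx₁
  exact π_eq_vertex_of_not_mem_regularLocus k f hf v hv 𝔪 h𝔪 x₁ hx₁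

/-- **`𝓚_E ≠ ⊥`**: the blow-up has a regular point (over the generic point of `G`), so `Z ≠ X₁` and the vanishing ideal sheaf of `Z` is not the zero ideal
(whose support is everything). [folklore] -/
theorem vanishingIdeal_ne_bot [CharP k 2] (f : MvPolynomial (Fin 5) k)
    (hf : f = X 0 * X 1 + X 2 ^ 3 + X 3 ^ 3 + X 4 ^ 3)
    (v : Spec (.of (MvPolynomial (Fin 5) k ⧸ Ideal.span {f})))
    (hv : v.asIdeal = Ideal.span (Set.range fun j : Fin 5 => Ideal.Quotient.mk (Ideal.span {f}) (X j)))
    (𝔪 : Ideal (MvPolynomial (Fin 5) k ⧸ Ideal.span {f})) (h𝔪 : 𝔪 = Ideal.span (Set.range fun j : Fin 5 => Ideal.Quotient.mk (Ideal.span {f}) (X j)))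
    (Z : Closeds ↥(affineBlowup 𝔪)) (hZ : (Z : Set ↥(affineBlowup 𝔪)) = (Scheme.regularLocus (affineBlowup 𝔪))ᶜ) :
    Scheme.IdealSheafData.vanishingIdeal Z ≠ ⊥ := by
  intro h0
  obtain ⟨x₁, -, -, hreg⟩ := exists_over_generic k f hf v hv 𝔪 h𝔪
  have hsupp := Scheme.IdealSheafData.coe_support_vanishingIdeal Z
  rw [h0, Scheme.IdealSheafData.support_bot, hZ] at hsupp
  have : x₁ ∈ (Scheme.regularLocus (affineBlowup 𝔪))ᶜ := by rw [← hsupp]; simp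
  exact this hreg

/-- ★ **`h𝓚`**: the singular centre does not vanish on the local model `X₁ ×_G Spec 𝒪_{G,v}`: `𝓚_E.comap (pullback.fst π₁ (G.fromSpecStalk v)) ≠ ⊥`. If it vanished,
its support — the preimage of `Z` — would be the whole local model, whose image in `X₁` is the set of points over generizations of `v` (Stacks 01J7) and contains
a point over the generic point of `G`, which is regular (§1). [cite: GortzWedhorn2020, Prop. 13.91 (2)] [cite: StacksProject, Tag 01J7] -/
theorem comap_pullback_fst_vanishingIdeal_ne_bot [CharP k 2] (f : MvPolynomial (Fin 5) k)
    (hf : f = X 0 * X 1 + X 2 ^ 3 + X 3 ^ 3 + X 4 ^ 3)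
    (v : Spec (.of (MvPolynomial (Fin 5) k ⧸ Ideal.span {f})))
    (hv : v.asIdeal = Ideal.span (Set.range fun j : Fin 5 => Ideal.Quotient.mk (Ideal.span {f}) (X j)))
    (𝔪 : Ideal (MvPolynomial (Fin 5) k ⧸ Ideal.span {f})) (h𝔪 : 𝔪 = Ideal.span (Set.range fun j : Fin 5 => Ideal.Quotient.mk (Ideal.span {f}) (X j)))
    (Z : Closeds ↥(affineBlowup 𝔪)) (hZ : (Z : Set ↥(affineBlowup 𝔪)) = (Scheme.regularLocus (affineBlowup 𝔪))ᶜ) :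
    (Scheme.IdealSheafData.vanishingIdeal Z).comap
      (Limits.pullback.fst (affineBlowup.π 𝔪) ((Spec (.of (MvPolynomial (Fin 5) k ⧸ Ideal.span {f}))).fromSpecStalk v)) ≠ ⊥ := by
  intro h0
  obtain ⟨x₁, hgen, hne, hreg⟩ := exists_over_generic k f hf v hv 𝔪 h𝔪
  -- `x₁` lies in the image of the local model
  have hmem : x₁ ∈ Set.range (Limits.pullback.fst (affineBlowup.π 𝔪) ((Spec (.of (MvPolynomial (Fin 5) k ⧸ Ideal.span {f}))).fromSpecStalk v)) := by
    rw [range_pullback_fst_fromSpecStalk]; exact hgen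
  obtain ⟨t, rfl⟩ := hmem
  -- the pulled-back centre vanishes, so its support is everything; and its support is the preimage of `Z`
  have ht : t ∈ ((((Scheme.IdealSheafData.vanishingIdeal Z).comap
      (Limits.pullback.fst (affineBlowup.π 𝔪) ((Spec (.of (MvPolynomial (Fin 5) k ⧸ Ideal.span {f}))).fromSpecStalk v))).support : Set _)) := by
    rw [h0, Scheme.IdealSheafData.support_bot]; simp
  rw [Scheme.IdealSheafData.support_comap] at ht
  have ht' : (Limits.pullback.fst (affineBlowup.π 𝔪) ((Spec (.of (MvPolynomial (Fin 5) k ⧸ Ideal.span {f}))).fromSpecStalk v)).base t ∈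
      ((Scheme.IdealSheafData.vanishingIdeal Z).support : Set _) := ht
  rw [Scheme.IdealSheafData.coe_support_vanishingIdeal, hZ] at ht'
  exact ht' hreg

end Summit.ResolutionOfSingularities.ResolutionOfSingularities.Theorems.FInjectiveMacaulayfication.E4GermSingularCentre

end
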